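import Summits.CriticalPhenomena.CardyFormulaZ2.Theses.CardySelfRefinement
import Summits.CriticalPhenomena.CardyFormulaZ2.Theorems.CardySelfRefinementLagHandOffKernelGluing
import Literature.Probability.RandomPlanarGeometry.StopAtShrinking
import Mathlib.Probability.Martingale.Convergence
import Mathlib.Probability.Kernel.CondDistrib
import HarnessLib

/-!
# Left-continuity of a Markov kernel along shrinking stopping sets is automatic (Lévy–Hunt):
# partial helper for stub `stub_slitHandOff` (R2″) of line `hitting-tournament` for crux
# `LagHandOff` (stmt-CriticalPhenomena-10268)

The CONVERSE of kernel gluing (`markov_iInter_of_tendsto`, `…LagHandOffKernelGluing.lean`).  Let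
`P` be a finite law on curve classes and `Q` a measurable family of probability laws along pasts
which disintegrates `P` at the first hitting of the closed sets `F₀ ⊇ F₁ ⊇ ⋯` AND at
`F = ⋂ F_k`.  Then for every bounded continuous `g`, `P`-a.s.
`∫ g dQ(γ.stopAt F_k) → ∫ g dQ(γ.stopAt F)` (`tendsto_integral_of_markov_iInter`; registered
form `stub_slitHandOff_martingale`).  Proof: the pasts generate an INCREASING sequence of
σ-algebras `σ(stopAt F_k)` (`stopAt F_k = stopAt F_k ∘ stopAt F_l`, `k ≤ l`), all contained in
`σ(stopAt F)`; the disintegration identity at a closed set `G` says exactly that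
`γ ↦ ∫ g dQ(γ.stopAt G)` is a version of `E[g (startFrom G) | σ(stopAt G)]`
(`condExp_comp_startFrom_ae_eq`, via Mathlib's `condDistrib`); Lévy's upward theorem
(`MeasureTheory.tendsto_ae_condExp`) gives `E[g (startFrom F) | σ(stopAt F_k)] →
E[g (startFrom F) | ⋁ σ(stopAt F_k)] = ∫ g dQ(γ.stopAt F)` a.s. (the limit past `stopAt F` is
`⋁`-measurable as the pointwise limit of `stopAt F_k`, `tendsto_stopAt_iInter`), and Hunt's lemma
(`ae_tendsto_condExp_filtration_zero`: conditional expectations along a filtration of bounded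
functions tending to `0`) absorbs the moving integrands
`|g (startFrom F_k) − g (startFrom F)| → 0` (`tendsto_startFrom_iInter`).

Consequence for the crux (recorded in `…LagHandOffSlitHandOffDyadic.lean`): given the slit
identification on a class of stopping sets, a.s. left-continuity of the slit kernel along an
announcing sequence `G_k ↓ F` is EQUIVALENT to the disintegration identity at `F`; hence
`stub_slitHandOff`, its dyadic form `H_𝒟`, and "one configuration-indexed kernel disintegrates
every `P D` at every closed `F`" are equivalent — the regularity clause of `H_𝒟` loses nothing.

References: P.-A. Meyer, Probability and Potentials (1966) / C. Dellacherie, P.-A. Meyer,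
Probabilités et potentiel B, ch. V (Hunt's lemma, théorème de convergence des espérances
conditionnelles); P. Lévy (upward theorem), as in Mathlib `Probability/Martingale/Convergence`;
F. B. Knight, Ann. Probab. 3 (1975) 573–596.
-/

noncomputable section

open MeasureTheory ProbabilityTheory Filter Set Topology
open scoped BoundedContinuousFunction unitInterval ENNReal NNReal
open Literature.Probability.RandomPlanarGeometry

namespace Summit.CriticalPhenomena.CardyFormulaZ2.Cruxes.LagHandOff.HittingTournament

open Summit.CriticalPhenomena.CardyFormulaZ2.Cruxes.LagHandOff.CrosscutDictionary

section Hunt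

variable {Ω : Type*} {m m0 : MeasurableSpace Ω} (μ : Measure Ω) [IsFiniteMeasure μ]

/-- **Conditional monotone convergence, a.e. form.** If measurable functions
`0 ≤ H n ≤ C` decrease pointwise to `0`, their conditional expectations given a sub-σ-algebra
tend to `0` almost everywhere: a.e. they are nonnegative and decrease, so converge to a limit
`L ≥ 0` with `∫ L ≤ ∫ E[H n | m] = ∫ H n → 0`. [folklore] -/
theorem ae_tendsto_condExp_zero_of_antitone (hm : m ≤ m0) {H : ℕ → Ω → ℝ} (hHm : ∀ n, Measurable (H n)) {C : ℝ}
    (h0 : ∀ n ω, 0 ≤ H n ω) (hC : ∀ n ω, H n ω ≤ C) (hanti : ∀ ω, Antitone fun n => H n ω)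
    (hlim : ∀ ω, Tendsto (fun n => H n ω) atTop (𝓝 0)) :
    ∀ᵐ ω ∂μ, Tendsto (fun n => (μ[H n | m]) ω) atTop (𝓝 0) := by
  have hint : ∀ n, Integrable (H n) μ := fun n =>
    (integrable_const C).mono' (hHm n).aestronglyMeasurable
      (Eventually.of_forall fun ω => by
        rw [Real.norm_eq_abs, abs_of_nonneg (h0 n ω)]
        exact hC n ω)
  -- a.e. the conditional expectations are nonnegative and decrease, hence converge
  have hY0 : ∀ᵐ ω ∂μ, ∀ n, 0 ≤ (μ[H n | m]) ω :=
    ae_all_iff.2 fun n => condExp_nonneg (Eventually.of_forall (h0 n))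
  have hYanti : ∀ᵐ ω ∂μ, Antitone fun n => (μ[H n | m]) ω := by
    have h : ∀ n, μ[H (n + 1) | m] ≤ᵐ[μ] μ[H n | m] := fun n =>
      condExp_mono (hint (n + 1)) (hint n) (Eventually.of_forall fun ω => hanti ω (Nat.le_succ n))
    filter_upwards [ae_all_iff.2 h] with ω hω
    exact antitone_nat_of_succ_le hω
  set L : Ω → ℝ := fun ω => ⨅ n, (μ[H n | m]) ω with hL
  have hLmeas : Measurable L :=
    Measurable.iInf fun n => (stronglyMeasurable_condExp (m := m) (μ := μ) (f := H n)).measurable.mono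
      hm le_rfl
  have hbdd : ∀ ω, (∀ n, 0 ≤ (μ[H n | m]) ω) → BddBelow (Set.range fun n => (μ[H n | m]) ω) :=
    fun ω hω => ⟨0, by rintro _ ⟨n, rfl⟩; exact hω n⟩
  have hconvL : ∀ᵐ ω ∂μ, Tendsto (fun n => (μ[H n | m]) ω) atTop (𝓝 (L ω)) := by
    filter_upwards [hY0, hYanti] with ω h0ω hantiω
    exact tendsto_atTop_ciInf hantiω (hbdd ω h0ω)
  -- `0 ≤ L ≤ E[H 0 | m] ≤ C` a.e., so `L` is integrable
  have hL0 : 0 ≤ᵐ[μ] L := by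
    filter_upwards [hY0] with ω h0ω
    exact le_ciInf fun n => h0ω n
  have hLle : ∀ n, L ≤ᵐ[μ] μ[H n | m] := fun n => by
    filter_upwards [hY0] with ω h0ω
    exact ciInf_le (hbdd ω h0ω) n
  have hLint : Integrable L μ :=
    (integrable_condExp (f := H 0) (m := m) (μ := μ)).mono' hLmeas.aestronglyMeasurable (by
      filter_upwards [hL0, hLle 0] with ω h1 h2
      rw [Real.norm_eq_abs, abs_of_nonneg h1]
      exact h2)
  -- `∫ H n → 0`, hence `∫ L ≤ 0`, hence `L = 0` a.e.
  have hintH : Tendsto (fun n => ∫ ω, H n ω ∂μ) atTop (𝓝 0) := by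
    have h := tendsto_integral_of_dominated_convergence (μ := μ) (fun _ => C)
      (fun n => (hHm n).aestronglyMeasurable) (integrable_const C)
      (fun n => Eventually.of_forall fun ω => by
        rw [Real.norm_eq_abs, abs_of_nonneg (h0 n ω)]
        exact hC n ω)
      (Eventually.of_forall hlim)
    simpa using h
  have hintL : ∫ ω, L ω ∂μ ≤ 0 := by
    refine ge_of_tendsto' hintH fun n => ?_
    rw [← integral_condExp hm (f := H n) (μ := μ)]
    exact integral_mono_ae hLint integrable_condExp (hLle n)
  have hL_ae : L =ᵐ[μ] 0 :=
    (integral_eq_zero_iff_of_nonneg_ae hL0 hLint).1 (le_antisymm hintL (integral_nonneg_of_ae hL0))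
  filter_upwards [hconvL, hL_ae] with ω h1 h2
  rwa [h2] at h1

/-- **Hunt's lemma (bounded, nonnegative case).** Along a filtration `ℱ`, if measurable functions
`0 ≤ h k ≤ C` tend to `0` pointwise, then `E[h k | ℱ k] → 0` almost everywhere: for `k ≥ m`,
`E[h k | ℱ k] ≤ E[H m | ℱ k]` with `H m = sup_{k ≥ m} h k`, which tends to `E[H m | ⋁ ℱ]` as
`k → ∞` (Lévy's upward theorem), and `E[H m | ⋁ ℱ] ↓ 0` (conditional monotone convergence).
[folklore] -/
theorem ae_tendsto_condExp_filtration_zero (ℱ : Filtration ℕ m0) {h : ℕ → Ω → ℝ}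
    (hhm : ∀ k, Measurable (h k)) {C : ℝ} (h0 : ∀ k ω, 0 ≤ h k ω)
    (hC : ∀ k ω, h k ω ≤ C) (hlim : ∀ ω, Tendsto (fun k => h k ω) atTop (𝓝 0)) :
    ∀ᵐ ω ∂μ, Tendsto (fun k => (μ[h k | ℱ k]) ω) atTop (𝓝 0) := by
  -- running suprema `H m = sup_{k ≥ m} h k`
  set H : ℕ → Ω → ℝ := fun m ω => ⨆ k, h (m + k) ω with hH
  have hbdd : ∀ m ω, BddAbove (Set.range fun k => h (m + k) ω) :=
    fun m ω => ⟨C, by rintro _ ⟨k, rfl⟩; exact hC _ ω⟩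
  have hHm : ∀ m, Measurable (H m) := fun m => Measurable.iSup fun k => hhm (m + k)
  have hhH : ∀ m k ω, m ≤ k → h k ω ≤ H m ω := fun m k ω hmk => by
    obtain ⟨j, rfl⟩ := Nat.exists_eq_add_of_le hmk
    exact le_ciSup (hbdd m ω) j
  have hH0 : ∀ m ω, 0 ≤ H m ω := fun m ω => (h0 m ω).trans (hhH m m ω le_rfl)
  have hHC : ∀ m ω, H m ω ≤ C := fun m ω => ciSup_le fun k => hC _ ω
  have hHanti : ∀ ω, Antitone fun m => H m ω := fun ω =>
    antitone_nat_of_succ_le fun m => ciSup_le fun k => hhH m (m + 1 + k) ω (by omega)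
  have hHlim : ∀ ω, Tendsto (fun m => H m ω) atTop (𝓝 0) := fun ω => by
    refine tendsto_order.2 ⟨fun a ha => Eventually.of_forall fun m => ha.trans_le (hH0 m ω),
      fun b hb => ?_⟩
    obtain ⟨N, hN⟩ := eventually_atTop.1 ((tendsto_order.1 (hlim ω)).2 (b / 2) (half_pos hb))
    refine eventually_atTop.2 ⟨N, fun m hm => (ciSup_le fun k => (hN (m + k) (by omega)).le).trans_lt
      (half_lt_self hb)⟩
  -- integrability
  have hint : ∀ k, Integrable (h k) μ := fun k =>
    (integrable_const C).mono' (hhm k).aestronglyMeasurable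
      (Eventually.of_forall fun ω => by
        rw [Real.norm_eq_abs, abs_of_nonneg (h0 k ω)]
        exact hC k ω)
  have hintH : ∀ m, Integrable (H m) μ := fun m =>
    (integrable_const C).mono' (hHm m).aestronglyMeasurable
      (Eventually.of_forall fun ω => by
        rw [Real.norm_eq_abs, abs_of_nonneg (hH0 m ω)]
        exact hHC m ω)
  -- (A) comparison `E[h k | ℱ k] ≤ E[H m | ℱ k]` for `k ≥ m`
  have hA : ∀ᵐ ω ∂μ, ∀ m k, m ≤ k → (μ[h k | ℱ k]) ω ≤ (μ[H m | ℱ k]) ω := by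
    have h' : ∀ m k, ∀ᵐ ω ∂μ, m ≤ k → (μ[h k | ℱ k]) ω ≤ (μ[H m | ℱ k]) ω := fun m k => by
      by_cases hmk : m ≤ k
      · filter_upwards [condExp_mono (m := ℱ k) (hint k) (hintH m)
          (Eventually.of_forall fun ω => hhH m k ω hmk)] with ω hω _
        exact hω
      · exact Eventually.of_forall fun ω h => absurd h hmk
    exact ae_all_iff.2 fun m => ae_all_iff.2 fun k => h' m k
  -- (B) Lévy's upward theorem in `k`, for each `m`
  have hB : ∀ᵐ ω ∂μ, ∀ m,
      Tendsto (fun k => (μ[H m | ℱ k]) ω) atTop (𝓝 ((μ[H m | ⨆ k, ℱ k]) ω)) :=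
    ae_all_iff.2 fun m => tendsto_ae_condExp (H m)
  -- (C) conditional monotone convergence in `m` at the limit σ-algebra
  have hC' : ∀ᵐ ω ∂μ, Tendsto (fun m => (μ[H m | ⨆ k, ℱ k]) ω) atTop (𝓝 0) :=
    ae_tendsto_condExp_zero_of_antitone μ (iSup_le fun k => ℱ.le k) hHm hH0 hHC hHanti hHlim
  -- (D) nonnegativity
  have hD : ∀ᵐ ω ∂μ, ∀ k, 0 ≤ (μ[h k | ℱ k]) ω :=
    ae_all_iff.2 fun k => condExp_nonneg (Eventually.of_forall (h0 k))
  filter_upwards [hA, hB, hC', hD] with ω hAω hBω hCω hDω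
  refine tendsto_order.2 ⟨fun a ha => Eventually.of_forall fun k => ha.trans_le (hDω k),
    fun b hb => ?_⟩
  obtain ⟨m, hm⟩ := ((tendsto_order.1 hCω).2 b hb).exists
  filter_upwards [(tendsto_order.1 (hBω m)).2 b hm, eventually_ge_atTop m] with k hk1 hk2
  exact (hAω m k hk2).trans_lt hk1

end Hunt

section Past

variable {E : Type*} [MetricSpace E] [CompleteSpace E] [SecondCountableTopology E]

/-- **The pasts form a filtration.** For closed `A ⊆ S` the past at `S` is a (Borel) function
of the past at `A` (`stopAt S = stopAt S ∘ stopAt A`), so `σ(stopAt S) ≤ σ(stopAt A)`.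
[folklore] -/
theorem comap_stopAt_le_of_subset {A S : Set E} (hA : IsClosed A) (hS : IsClosed S) (hAS : A ⊆ S) :
    MeasurableSpace.comap (CurveClass.stopAt S) (inferInstance : MeasurableSpace (CurveClass E)) ≤
      MeasurableSpace.comap (CurveClass.stopAt A) inferInstance := by
  have h : (CurveClass.stopAt S : CurveClass E → CurveClass E) =
      CurveClass.stopAt S ∘ CurveClass.stopAt A :=
    funext fun c => (CurveClass.stopAt_stopAt_eq_stopAt hA hS hAS c).symm
  calc MeasurableSpace.comap (CurveClass.stopAt S) (inferInstance : MeasurableSpace (CurveClass E))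
      = (MeasurableSpace.comap (CurveClass.stopAt S)
          (inferInstance : MeasurableSpace (CurveClass E))).comap (CurveClass.stopAt A) := by
        rw [MeasurableSpace.comap_comp, ← h]
    _ ≤ MeasurableSpace.comap (CurveClass.stopAt A) inferInstance :=
        MeasurableSpace.comap_mono (measurable_stopAt hS).comap_le

/-- **The disintegration identity is a conditional expectation.** If `Q` (measurable family of
probability laws) disintegrates the finite law `P` at the closed set `G`, then for every bounded
continuous `g`, `γ ↦ ∫ g dQ(γ.stopAt G)` is a version of `E[g (startFrom G) | σ(stopAt G)]`:
the identity says that the joint law of `(stopAt G, startFrom G)` is `(stopAt G)_* P ⊗ Q`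
(`Measure.ext_prod`), so `Q` is a version of Mathlib's `condDistrib`
(`condDistrib_ae_eq_of_measure_eq_compProd`, `condExp_ae_eq_integral_condDistrib`). [folklore] -/
theorem condExp_comp_startFrom_ae_eq [Nonempty E] (P : Measure (CurveClass E)) [IsFiniteMeasure P]
    (Q : CurveClass E → Measure (CurveClass E)) (hprob : ∀ p, IsProbabilityMeasure (Q p))
    (hQm : ∀ T : Set (CurveClass E), MeasurableSet T → Measurable fun p => Q p T)
    {G : Set E} (hG : IsClosed G)
    (hmk : ∀ S T : Set (CurveClass E), MeasurableSet S → MeasurableSet T →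
      P (CurveClass.stopAt G ⁻¹' S ∩ CurveClass.startFrom G ⁻¹' T) =
        ∫⁻ γ in CurveClass.stopAt G ⁻¹' S, Q (γ.stopAt G) T ∂P)
    (g : CurveClass E →ᵇ ℝ) :
    P[fun γ => g (γ.startFrom G) | MeasurableSpace.comap (CurveClass.stopAt G) inferInstance] =ᵐ[P]
      fun γ => ∫ x, g x ∂Q (γ.stopAt G) := by
  haveI : Nonempty (CurveClass E) := ⟨CurveClass.mk (Curve.const (Classical.arbitrary E))⟩
  have hs := measurable_stopAt (E := E) hG
  have hr := measurable_startFrom (E := E) hG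
  let κ : Kernel (CurveClass E) (CurveClass E) := ⟨Q, Measure.measurable_of_measurable_coe Q hQm⟩
  haveI : IsMarkovKernel κ := ⟨hprob⟩
  have hcomp : P.map (fun γ => (γ.stopAt G, γ.startFrom G)) = P.map (CurveClass.stopAt G) ⊗ₘ κ := by
    refine Measure.ext_prod fun {S} {T} hS hT => ?_
    rw [Measure.map_apply (hs.prodMk hr) (hS.prod hT), mk_preimage_prod,
      Measure.compProd_apply_prod hS hT, setLIntegral_map hS (κ.measurable_coe hT) hs]
    exact hmk S T hS hT
  have h1 := condDistrib_ae_eq_of_measure_eq_compProd (CurveClass.stopAt G) hr.aemeasurable hcomp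
  have hint : Integrable (fun γ => g (γ.startFrom G)) P :=
    (integrable_const ‖g‖).mono' (g.continuous.measurable.comp hr).aestronglyMeasurable
      (Eventually.of_forall fun γ => g.norm_coe_le_norm _)
  have h2 := condExp_ae_eq_integral_condDistrib hs hr.aemeasurable g.continuous.stronglyMeasurable
    hint
  filter_upwards [h2, ae_of_ae_map hs.aemeasurable h1] with γ hγ2 hγ1
  rw [hγ2, hγ1]
  rfl

/-- **Left-continuity of a disintegrating kernel along shrinking stopping sets (converse of
kernel gluing).** Let `P` be a finite law on curve classes and `Q` a measurable family of
probability laws which disintegrates `P` at the first hitting of the closed sets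
`F₀ ⊇ F₁ ⊇ ⋯` and of `⋂ F_k`.  Then for every bounded continuous `g`, `P`-a.s.
`∫ g dQ(γ.stopAt F_k) → ∫ g dQ(γ.stopAt (⋂ F_k))`: Lévy's upward theorem along the filtration
`σ(stopAt F_k) ↑`, whose join measures the limit past `stopAt (⋂ F_k) = lim stopAt F_k`, plus
Hunt's lemma for the moving integrands `g (startFrom F_k) → g (startFrom (⋂ F_k))`. [folklore] -/
theorem tendsto_integral_of_markov_iInter [Nonempty E] (P : Measure (CurveClass E))
    [IsFiniteMeasure P] (Q : CurveClass E → Measure (CurveClass E))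
    (hprob : ∀ p, IsProbabilityMeasure (Q p))
    (hQm : ∀ T : Set (CurveClass E), MeasurableSet T → Measurable fun p => Q p T)
    {F : ℕ → Set E} (hF : ∀ k, IsClosed (F k)) (hanti : Antitone F)
    (hmarkov : ∀ k, ∀ S T : Set (CurveClass E), MeasurableSet S → MeasurableSet T →
      P (CurveClass.stopAt (F k) ⁻¹' S ∩ CurveClass.startFrom (F k) ⁻¹' T) =
        ∫⁻ γ in CurveClass.stopAt (F k) ⁻¹' S, Q (γ.stopAt (F k)) T ∂P)
    (hlim : ∀ S T : Set (CurveClass E), MeasurableSet S → MeasurableSet T →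
      P (CurveClass.stopAt (⋂ k, F k) ⁻¹' S ∩ CurveClass.startFrom (⋂ k, F k) ⁻¹' T) =
        ∫⁻ γ in CurveClass.stopAt (⋂ k, F k) ⁻¹' S, Q (γ.stopAt (⋂ k, F k)) T ∂P)
    (g : CurveClass E →ᵇ ℝ) :
    ∀ᵐ γ ∂P, Tendsto (fun k => ∫ x, g x ∂Q (γ.stopAt (F k))) atTop
      (𝓝 (∫ x, g x ∂Q (γ.stopAt (⋂ k, F k)))) := by
  haveI : Nonempty (CurveClass E) := ⟨CurveClass.mk (Curve.const (Classical.arbitrary E))⟩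
  have hFi : IsClosed (⋂ k, F k) := isClosed_iInter hF
  have hsi := measurable_stopAt (E := E) hFi
  have hri := measurable_startFrom (E := E) hFi
  -- the filtration of the pasts and the σ-algebra of the limit past
  obtain ⟨ℱ, hℱ⟩ : ∃ ℱ : Filtration ℕ (inferInstance : MeasurableSpace (CurveClass E)),
      ∀ k, (ℱ k : MeasurableSpace (CurveClass E)) =
        MeasurableSpace.comap (CurveClass.stopAt (F k)) inferInstance :=
    ⟨{ seq := fun k => MeasurableSpace.comap (CurveClass.stopAt (F k)) inferInstance,
       mono' := fun k l hkl => comap_stopAt_le_of_subset (hF l) (hF k) (hanti hkl),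
       le' := fun k => (measurable_stopAt (hF k)).comap_le }, fun k => rfl⟩
  have hmIle : MeasurableSpace.comap (CurveClass.stopAt (⋂ k, F k))
      (inferInstance : MeasurableSpace (CurveClass E)) ≤
        (inferInstance : MeasurableSpace (CurveClass E)) := hsi.comap_le
  have hsuple : (⨆ k, (ℱ k : MeasurableSpace (CurveClass E))) ≤
      (inferInstance : MeasurableSpace (CurveClass E)) := iSup_le fun k => ℱ.le k
  have hsupI : (⨆ k, (ℱ k : MeasurableSpace (CurveClass E))) ≤
      MeasurableSpace.comap (CurveClass.stopAt (⋂ k, F k)) inferInstance :=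
    iSup_le fun k => (le_of_eq (hℱ k)).trans
      (comap_stopAt_le_of_subset hFi (hF k) (iInter_subset F k))
  -- the kernel as a Mathlib kernel; measurability of `p ↦ ∫ g dQ p`
  let κ : Kernel (CurveClass E) (CurveClass E) := ⟨Q, Measure.measurable_of_measurable_coe Q hQm⟩
  haveI : IsMarkovKernel κ := ⟨hprob⟩
  have hΦ : StronglyMeasurable fun p : CurveClass E => ∫ x, g x ∂(κ p) :=
    (g.continuous.stronglyMeasurable.comp_measurable measurable_snd).integral_kernel_prod_right'
      (κ := κ)
  -- the limit past is measurable for the join of the filtration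
  have hstop_meas : Measurable[⨆ k, (ℱ k : MeasurableSpace (CurveClass E))]
      (CurveClass.stopAt (⋂ k, F k) : CurveClass E → CurveClass E) := by
    have hk : ∀ k, Measurable[⨆ k, (ℱ k : MeasurableSpace (CurveClass E))]
        (CurveClass.stopAt (F k) : CurveClass E → CurveClass E) := fun k =>
      (Measurable.of_comap_le (le_of_eq (hℱ k).symm)).mono
        (le_iSup (fun k => (ℱ k : MeasurableSpace (CurveClass E))) k) le_rfl
    exact @measurable_of_tendsto_metrizable _ _ (⨆ k, (ℱ k : MeasurableSpace (CurveClass E)))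
      _ _ _ _ _ _ hk (tendsto_pi_nhds.2 fun c => tendsto_stopAt_iInter hF hanti c)
  -- integrands
  set gF : ℕ → CurveClass E → ℝ := fun k γ => g (γ.startFrom (F k)) with hgF
  set gI : CurveClass E → ℝ := fun γ => g (γ.startFrom (⋂ k, F k)) with hgI
  have hgFm : ∀ k, Measurable (gF k) := fun k =>
    g.continuous.measurable.comp (measurable_startFrom (hF k))
  have hgIm : Measurable gI := g.continuous.measurable.comp hri
  have hintF : ∀ k, Integrable (gF k) P := fun k =>
    (integrable_const ‖g‖).mono' (hgFm k).aestronglyMeasurable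
      (Eventually.of_forall fun γ => g.norm_coe_le_norm _)
  have hintI : Integrable gI P :=
    (integrable_const ‖g‖).mono' hgIm.aestronglyMeasurable
      (Eventually.of_forall fun γ => g.norm_coe_le_norm _)
  -- (1) the kernel integrals are the conditional expectations along the filtration
  have h1 : ∀ᵐ γ ∂P, ∀ k, (P[gF k | ℱ k]) γ = ∫ x, g x ∂Q (γ.stopAt (F k)) :=
    ae_all_iff.2 fun k => by
      rw [hℱ k]
      exact condExp_comp_startFrom_ae_eq P Q hprob hQm (hF k) (hmarkov k) g
  -- (2)–(3) at the limit: `E[gI | ⋁ ℱ] = ∫ g dQ(stopAt (⋂ F_k))` a.e.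
  have h2 : P[gI | MeasurableSpace.comap (CurveClass.stopAt (⋂ k, F k)) inferInstance] =ᵐ[P]
      fun γ => ∫ x, g x ∂Q (γ.stopAt (⋂ k, F k)) :=
    condExp_comp_startFrom_ae_eq P Q hprob hQm hFi hlim g
  have hMIsm : StronglyMeasurable[⨆ k, (ℱ k : MeasurableSpace (CurveClass E))]
      fun γ : CurveClass E => ∫ x, g x ∂Q (γ.stopAt (⋂ k, F k)) :=
    hΦ.comp_measurable hstop_meas
  have hMIint : Integrable (fun γ : CurveClass E => ∫ x, g x ∂Q (γ.stopAt (⋂ k, F k))) P :=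
    (integrable_const ‖g‖).mono' (hΦ.measurable.comp hsi).aestronglyMeasurable
      (Eventually.of_forall fun γ => by
        haveI := hprob (γ.stopAt (⋂ k, F k))
        refine (norm_integral_le_integral_norm _).trans ?_
        calc ∫ x, ‖g x‖ ∂Q (γ.stopAt (⋂ k, F k)) ≤ ∫ _, ‖g‖ ∂Q (γ.stopAt (⋂ k, F k)) :=
              integral_mono_of_nonneg (Eventually.of_forall fun _ => norm_nonneg _)
                (integrable_const _) (Eventually.of_forall fun x => g.norm_coe_le_norm x)
          _ = ‖g‖ := by simp)
  have h3 : P[gI | ⨆ k, (ℱ k : MeasurableSpace (CurveClass E))] =ᵐ[P]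
      fun γ => ∫ x, g x ∂Q (γ.stopAt (⋂ k, F k)) :=
    calc P[gI | ⨆ k, (ℱ k : MeasurableSpace (CurveClass E))]
        =ᵐ[P] P[P[gI | MeasurableSpace.comap (CurveClass.stopAt (⋂ k, F k)) inferInstance] |
            ⨆ k, (ℱ k : MeasurableSpace (CurveClass E))] :=
          (condExp_condExp_of_le hsupI hmIle).symm
      _ =ᵐ[P] P[fun γ => ∫ x, g x ∂Q (γ.stopAt (⋂ k, F k)) |
            ⨆ k, (ℱ k : MeasurableSpace (CurveClass E))] := condExp_congr_ae h2
      _ = fun γ => ∫ x, g x ∂Q (γ.stopAt (⋂ k, F k)) :=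
          condExp_of_stronglyMeasurable hsuple hMIsm hMIint
  -- (4) Lévy's upward theorem for the fixed integrand `gI`
  have h4 : ∀ᵐ γ ∂P, Tendsto (fun k => (P[gI | ℱ k]) γ) atTop
      (𝓝 ((P[gI | ⨆ k, (ℱ k : MeasurableSpace (CurveClass E))]) γ)) :=
    tendsto_ae_condExp gI
  -- (5) Hunt's lemma for the moving integrands
  have h5 : ∀ᵐ γ ∂P, Tendsto (fun k => (P[abs (gF k - gI) | ℱ k]) γ) atTop (𝓝 0) := by
    refine ae_tendsto_condExp_filtration_zero P ℱ (h := fun k => abs (gF k - gI))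
      (fun k => continuous_abs.measurable.comp ((hgFm k).sub hgIm)) (C := ‖g‖ + ‖g‖)
      (fun k γ => abs_nonneg _) (fun k γ => ?_) fun γ => ?_
    · change |g _ - g _| ≤ ‖g‖ + ‖g‖
      refine (abs_sub _ _).trans (add_le_add ?_ ?_) <;> rw [← Real.norm_eq_abs] <;>
        exact g.norm_coe_le_norm _
    · have hc : Tendsto (fun k => gF k γ) atTop (𝓝 (gI γ)) :=
        (g.continuous.tendsto _).comp (tendsto_startFrom_iInter hF hanti γ)
      have := (hc.sub_const (gI γ)).abs
      simpa using this
  -- (6) linearity and `|E[f | m]| ≤ E[|f| | m]`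
  have h6 : ∀ᵐ γ ∂P, ∀ k,
      |(P[gF k | ℱ k]) γ - (P[gI | ℱ k]) γ| ≤ (P[abs (gF k - gI) | ℱ k]) γ := by
    refine ae_all_iff.2 fun k => ?_
    filter_upwards [condExp_sub (hintF k) hintI (ℱ k),
      abs_condExp_ae_le_condExp_abs (m := ℱ k) (μ := P) (gF k - gI)] with γ hsub habs
    have h := habs
    rw [Pi.abs_apply, hsub, Pi.sub_apply] at h
    exact h
  -- assemble
  filter_upwards [h1, h3, h4, h5, h6] with γ h1γ h3γ h4γ h5γ h6γ
  have hlimit : Tendsto (fun k => (P[gF k | ℱ k]) γ) atTop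
      (𝓝 (∫ x, g x ∂Q (γ.stopAt (⋂ k, F k)))) := by
    have hdiff : Tendsto (fun k => (P[gF k | ℱ k]) γ - (P[gI | ℱ k]) γ) atTop (𝓝 0) :=
      squeeze_zero_norm (fun k => by rw [Real.norm_eq_abs]; exact h6γ k) h5γ
    have hsum := hdiff.add h4γ
    rw [h3γ, zero_add] at hsum
    simpa using hsum
  exact hlimit.congr fun k => h1γ k

end Past

/-- **Registered sub-goal `stub_slitHandOff_martingale` of `stub_slitHandOff` (R2″)**: the
converse of kernel gluing for laws of planar curve classes (`tendsto_integral_of_markov_iInter`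
at `E = ℂ`) — a measurable family of probability laws disintegrating a finite law at the closed
sets `F₀ ⊇ F₁ ⊇ ⋯` and at `⋂ F_k` is automatically a.s. weakly left-continuous along the pasts
`γ.stopAt F_k → γ.stopAt (⋂ F_k)` (Lévy's upward theorem + Hunt's lemma).  With
`stub_limitMarkov_kernelGluing` this makes the left-continuity clause of `stub_slitHandOff`
EQUIVALENT, given the identification at the `F_k`, to the identification at `⋂ F_k`. [folklore] -/
theorem stub_slitHandOff_martingale : ∀ (P : Measure (CurveClass ℂ)) [IsFiniteMeasure P] (Q : CurveClass ℂ → Measure (CurveClass ℂ)), (∀ p, IsProbabilityMeasure (Q p)) → (∀ T : Set (CurveClass ℂ), MeasurableSet T → Measurable fun p => Q p T) → ∀ F : ℕ → Set ℂ, (∀ k, IsClosed (F k)) → Antitone F → (∀ k, ∀ S T : Set (CurveClass ℂ), MeasurableSet S → MeasurableSet T → P (CurveClass.stopAt (F k) ⁻¹' S ∩ CurveClass.startFrom (F k) ⁻¹' T) = ∫⁻ γ in CurveClass.stopAt (F k) ⁻¹' S, Q (γ.stopAt (F k)) T ∂P) → (∀ S T : Set (CurveClass ℂ), MeasurableSet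 S → MeasurableSet T → P (CurveClass.stopAt (⋂ k, F k) ⁻¹' S ∩ CurveClass.startFrom (⋂ k, F k) ⁻¹' T) = ∫⁻ γ in CurveClass.stopAt (⋂ k, F k) ⁻¹' S, Q (γ.stopAt (⋂ k, F k)) T ∂P) → ∀ g : CurveClass ℂ →ᵇ ℝ, ∀ᵐ γ ∂P, Tendsto (fun k => ∫ x, g x ∂(Q (γ.stopAt (F k)))) atTop (𝓝 (∫ x, g x ∂(Q (γ.stopAt (⋂ k, F k))))) :=
  fun P _ Q hprob hQm _ hF hanti hmarkov hlim g =>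
    tendsto_integral_of_markov_iInter P Q hprob hQm hF hanti hmarkov hlim g

end Summit.CriticalPhenomena.CardyFormulaZ2.Cruxes.LagHandOff.HittingTournament

end
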